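import Mathlib
import Literature.MathematicalPhysics.QuantumFieldTheory.Balaban1983to89.B11SectG

/-!
# `Balaban1983to89.B11Reparam190` — [Balaban1985Variational] Sect. G, (190) p. 308: the decay (190) of the
functional derivative (δ/δB)𝓗 is STABLE UNDER A LOCAL LINEAR CHANGE OF THE DATUM B ↦ Φ(B′) — the "two-line chain
rule, printed nowhere" of cell GAPS G-B11-G5, KERNEL-CHECKED over the block-majorant vocabulary of `…B11SectG`, with
the rate ⅛δ₀ PRESERVED EXACTLY and the constant explicit.

CITATION HEADER (lean-in-tree rule 2026-08-18).  Source: T. Bałaban, *The variational problem and background fields in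
renormalization group method for lattice gauge theories*, Commun. Math. Phys. **102**, 277–309 (1985),
doi:10.1007/bf01229381 (cell paper B11; held `paper:balaban1985-cmp102-variational-background`; journal page = PDF page
+ 276).  Every quotation below was re-read for this module on the page renders
`b2b-balaban-ref1/pages/1985-cmp102-variational-background/…-p005,p026,p029,p033-x2.png` (pp. 281, 302, 305, 309) and
`b2b-balaban-ref1/pages/1987-cmp109-rg-I-small-field/…-p028-x2.png` ([Balaban1987RG1] p. 276).  References of the
paper: [3] = [Balaban1984PropagatorsII] ((2.54), Lemma 2.1; sibling modules `…B6`, `…B6RandomWalk`), [6] =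
[Balaban1985RegularSpaces] (Eqs. (1.31)).  This module only IMPORTS `…B11SectG` (`BlockNorm`, `HasMaj`, `hasMaj_comp`,
`HasMaj.add/mono/congr`, `Ineq190`) and modifies nothing there; the sibling `…B6RandomWalkHom` (unit pv21) has the
analogous one-lattice statements `majorant_mul_localRight` / `local_mul_majorant` in the `B6RandomWalk.HasMajorant`
vocabulary (functions on a lattice, sharp blocks) — the present statements are their `BlockNorm`/`HasMaj` versions
(abstract local sizes with a cutting cost κ, the vocabulary in which (190) is typed and consumed:
`B11SectG.Ineq190`, `B12Ineq45.loc_dH_le_of_ineq190_localised`, `B12Decay510FromB11.norm_dH_le`).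

WHAT THE PAPER PRINTS (and nothing else is attributed to it).
* p. 305 [PDF 29], opening of Sect. G, verbatim: *"We will show that it is an analytic function of V in the following
  sense: if V = V′V₀, V′ small, U₀ = U_k(V₀), and if we fix a gauge condition for U_k(V′V₀)U₀⁻¹, then it is an analytic
  function of B = 1/i log V′ and it has an expansion as a power series in B."*; (172), verbatim: *"|V′ − 1| < C₁ε₁,
  hence V′ = e^{iB′}, |B′| < 2C₁ε₁ on 𝔅_k, (172)"*; (174), verbatim: *"𝓗 = 𝒜₁ + H₁B − HD(𝒜₁ + H₁B), (174)"*.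
* Proposition 9, p. 309 [PDF 33], verbatim: *"The function U_k(V′V₀)U_k(V₀)⁻¹ transformed to the Landau gauge is, by
  the definition, equal to exp iη𝓗(B), where B = 1/i log V′. The function 𝓗(B) is determined by Eqs. (174), (175),
  or (179), (180). It is an analytic function of B, … It satisfies the conditions (19)–(21) with ε₂ = B₅ε₁ (see
  (173)), and its functional derivative (182) satisfies the inequalities (190)."*
* (20) p. 281 [PDF 5], verbatim: *"Q_j(U₀, ηA) = B on Λ_j, j = 0, 1, …, k, (20) where B is given by the formulas
  (1.31) in [6], hence |B| < 2dLC₁ε₁,"*; (154)–(156) p. 302 [PDF 26], verbatim: *"Ū₁^j(x, x′) = exp[−i Σ_{x₁∈B(x)}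
  L^{−d}(1/i) log V″(Γ_{x,x₁})]V″(x, x′) for ⟨x, x′⟩ ∈ Λ′_j, x ∈ Λ′_{j−1}, x′ ∈ Λ′_j, (154) by Eqs. (1.31) in [6]. If
  we denote by V₁ the configuration on the right-hand sides of (154), then V₁ = e^{iB} with |B| < 18d²L³Mε₀, (155) for
  c₁ sufficiently small, and the equalities (154) can be written as Q_j(ηA) = B on Λ′_j, j = 0, 1, …, k, or simply
  Q(ηA) = B. (156)"*.
* (190) p. 308 [PDF 32] is quoted in full in the docstring of `B11SectG.Ineq190` (typed there as the majorant
  C·e^{−⅛δ₀d(y,y′)} of δ𝓗 from the B-size `bB` into a local size `bout`).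
* The consumer, [Balaban1987RG1] p. 276 [PDF 28] (3.30), verbatim: *"A = (1/iη) log exp iηA exp iL⁻¹ηH_{k+1}(□₀,
  (1/i) log V), B = Q(ηA) on □₀. (3.30)"* and *"The function B above is defined on the set of bonds determining
  U_j(□₀), i.e. on (⋃_{n=0}^{j−1}Λ_n) ∪ □_j^{(j)}."* — the minimizers of [Balaban1987RG1] are differentiated with respect
  to the datum (1/i) log V on a multi-grid WITH interface bonds.

THE LOCATED POINT (cell GAPS G-B11-G5, gen 3; nothing of it is an error of the paper).  In (174)–(190) the datum B
is the image (20)/(154)–(156) of V′ under the formulas (1.31) of [6] — equal to (1/i) log V′ on the bonds inside one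
scale and corrected on the interface bonds ⟨x, x′⟩, x ∈ Λ′_{j−1}, x′ ∈ Λ′_j, by the one-block term of (154) — while
Prop. 9 and p. 305 write *"B = 1/i log V′"* (= the B′ of (172)) and [Balaban1987RG1] differentiates in (1/i) log V.
So (190) is CONSUMED through the change of variables B = Φ(B′): Φ analytic on (172), Φ = identity off the interface
bonds, DΦ = I + N with N supported at block distance ≤ 1 and with bounded column sums (G-B11-G5: *"‖N‖ ≤ d(L − 1)(1 +
O(C₁ε₁))"* and the scale factor L^d between adjacent levels — our reading, not printed).  The paper's sentence
structure treats the two data as the same letter; the missing step is the chain rule δ𝓗/δB′ = (δ𝓗/δB)∘DΦ together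
with the remark that a LOCAL right factor does not degrade an exponential majorant.  THAT REMARK IS THIS MODULE.

WHAT THIS MODULE PROVES (kernel-checked; [folklore] block-majorant bookkeeping; every analytic input a hypothesis).
(1) `hasMaj_comp_localRight` / `hasMaj_comp_localLeft`: an operator with majorant a·e^{−ρd(y,y′)} (ρ ≥ 0) composed on
    the right (resp. left) with an operator whose majorant K ≥ 0 is LOCAL — K(y″, y′) ≠ 0 ⇒ d(y″, y′) ≤ r — with
    column sums (resp. row sums) ≤ ν has the majorant κ·a·ν·e^{ρr}·e^{−ρd(y,y′)}: the SAME rate ρ, by the triangle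
    inequality (2.54) of [3] over the distance ≤ r; NO row sum of Lemma 2.1 [3] and no rate margin is spent (contrast
    `B11SectG.hasMaj_comp_exp`, which composes two decaying kernels at the cost ρ + σ ≤ ρ₁).
(2) `ineq190_comp_local`: (190) for δ𝓗 (constant C, rate ⅛δ₀) and a local right factor Φ′ (range r, column sums ν)
    give (190) for δ𝓗 ∘ Φ′ with constant κ_B·C·ν·e^{⅛δ₀r} and rate ⅛δ₀.
(3) `ineq190_reparam`: with DΦ = I + N, N local as above, (190) for δ𝓗 gives (190) for δ𝓗 ∘ DΦ = the B′-derivative,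
    constant C·(1 + κ_B ν e^{⅛δ₀r}), rate ⅛δ₀ — UNCHANGED; `ineq190_reparam_one` is the case r = 1 of G-B11-G5
    (constant C(1 + κ_B ν e^{⅛δ₀})); `ineq190_reparam_entries` is the entry-wise family form in which the consumers
    take (190) (`∀ i, Ineq190 bB (bout i) dH C δ₀`).
(4) `ineq190_postcomp_local`: the mirror statement for a local LEFT factor (a local linear operation on the output —
    e.g. a block-constant conjugation or a finite-difference operator read as an operator between two local sizes),
    constant κ_out·ν·C·e^{⅛δ₀r}, rate ⅛δ₀.

HONEST FRAMING / WHAT IS *NOT* PROVED OR ASSERTED.  (190) itself is NOT proved (it is the hypothesis `h190`; its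
author-omitted input (189) is cell GAPS G-B11-G2, KEY); the identification of the concrete DΦ of (154)/(1.31) [6] with
a local majorant of range 1 and its column-sum constant are NOT typed (readings recorded in G-B11-G5; the BlockNorm
vocabulary carries the scale factors inside the sizes); analyticity of Φ and the words *"finally Proposition 2 and
(181)"* (transport to the axial gauge and to orbits, cell GAPS G-B11-G2a) are NOT touched.  ABSOLUTE RULE of the cell:
no statement of the audited series enters as a cited fact — the [cite] tags below are LOCATORS of the printed shapes,
every declaration is a theorem proved here from its displayed hypotheses, and the module declares no `def` at all (in
particular no `def … : Prop` naming a printed claim).  Value = kernel home of a two-line chain rule (G-B11-G5 (α)) in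
the currency in which (190) is consumed; typed bookkeeping, NOT summit progress.  Unit `b2b-balaban-b11-g9` (paper
sub-cell B11, gen 9); companion rows: cell `GAPS.md` G-B11-G5, C-B11-G9a, `DIVERGENCE.md` D-B11-19,
`b2b-balaban-b11/B11.md` Gen-9 addendum.
-/

namespace Literature.MathematicalPhysics.QuantumFieldTheory.Balaban1983to89.B11Reparam190

open Literature.MathematicalPhysics.QuantumFieldTheory.Balaban1983to89
open Finset B6RandomWalk B11SectG

variable {g : B6.Geometry}
variable {F₁ F₂ F₃ : Type} [AddCommGroup F₁] [Module ℝ F₁] [AddCommGroup F₂] [Module ℝ F₂]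
  [AddCommGroup F₃] [Module ℝ F₃]

/-! ## The triangle inequality (2.54) [3] over a bounded distance

A kernel K on 𝔅 × 𝔅 is called LOCAL OF RANGE r below when K(y, y′) ≠ 0 forces d(y, y′) ≤ r (hypotheses `hloc`) —
the shape of an operator whose matrix elements vanish unless the two blocks are within multiscale distance r (for the
DΦ of (154)/(1.31) [6]: r = 1, *"x₁ ∈ B(x)"*). -/

/-- (2.54) [3] over a distance ≤ r on the RIGHT: d(y″, y′) ≤ r ⇒ e^{−ρd(y,y″)} ≤ e^{ρr}e^{−ρd(y,y′)} (ρ ≥ 0).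
[cite: Balaban1984PropagatorsII, (2.54) p.233] -/
theorem exp_shift_right {ρ r : ℝ} (htri : Triangle254 g) (hρ : 0 ≤ ρ) {a y b : g.Site}
    (hd : g.dist y b ≤ r) :
    Real.exp (-(ρ * g.dist a y)) ≤ Real.exp (ρ * r) * Real.exp (-(ρ * g.dist a b)) := by
  rw [← Real.exp_add]
  refine Real.exp_le_exp.mpr ?_
  have h1 : ρ * g.dist a b ≤ ρ * g.dist a y + ρ * g.dist y b := by
    have := mul_le_mul_of_nonneg_left (htri a y b) hρ
    rwa [mul_add] at this
  have h2 : ρ * g.dist y b ≤ ρ * r := mul_le_mul_of_nonneg_left hd hρ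
  linarith

/-- (2.54) [3] over a distance ≤ r on the LEFT: d(y, y″) ≤ r ⇒ e^{−ρd(y″,y′)} ≤ e^{ρr}e^{−ρd(y,y′)} (ρ ≥ 0).
[cite: Balaban1984PropagatorsII, (2.54) p.233] -/
theorem exp_shift_left {ρ r : ℝ} (htri : Triangle254 g) (hρ : 0 ≤ ρ) {a y b : g.Site}
    (hd : g.dist a y ≤ r) :
    Real.exp (-(ρ * g.dist y b)) ≤ Real.exp (ρ * r) * Real.exp (-(ρ * g.dist a b)) := by
  rw [← Real.exp_add]
  refine Real.exp_le_exp.mpr ?_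
  have h1 : ρ * g.dist a b ≤ ρ * g.dist a y + ρ * g.dist y b := by
    have := mul_le_mul_of_nonneg_left (htri a y b) hρ
    rwa [mul_add] at this
  have h2 : ρ * g.dist a y ≤ ρ * r := mul_le_mul_of_nonneg_left hd hρ
  linarith

/-! ## (1) A local factor does not degrade an exponential majorant -/

/-- **A LOCAL operator on the RIGHT of a decaying one, rate preserved.**  If T₁ : F₂ → F₃ has majorant
a₁·e^{−ρ₁d(y,y″)} (a₁, ρ₁ ≥ 0) and T₂ : F₁ → F₂ has a majorant K₂ ≥ 0 which is local of range r with column sums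
Σ_{y″} K₂(y″, y′) ≤ ν, then T₁T₂ has majorant κ₂·a₁·ν·e^{ρ₁r}·e^{−ρ₁d(y,y′)} — insert the partition of unity of F₂
(`B11SectG.hasMaj_comp`, [3] (2.52)–(2.55)) and use (2.54) over the distance ≤ r; no row sum of Lemma 2.1 is needed
and the rate ρ₁ is kept. [cite: Balaban1984PropagatorsII, (2.52)–(2.55) pp.232–233] -/
theorem hasMaj_comp_localRight {b₁ : BlockNorm g F₁} {b₂ : BlockNorm g F₂} {b₃ : BlockNorm g F₃}
    {T₁ : F₂ →ₗ[ℝ] F₃} {T₂ : F₁ →ₗ[ℝ] F₂} {K₂ : g.Site → g.Site → ℝ} {a₁ ρ₁ r ν : ℝ}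
    (htri : Triangle254 g) (ha₁ : 0 ≤ a₁) (hρ₁ : 0 ≤ ρ₁)
    (hK₂ : ∀ a b, 0 ≤ K₂ a b) (hloc : ∀ a b, K₂ a b ≠ 0 → g.dist a b ≤ r) (hcol : ∀ b, ∑ a : g.Site, K₂ a b ≤ ν)
    (h₁ : HasMaj b₂ b₃ T₁ (fun a b => a₁ * Real.exp (-(ρ₁ * g.dist a b))))
    (h₂ : HasMaj b₁ b₂ T₂ K₂) :
    HasMaj b₁ b₃ (T₁ ∘ₗ T₂)
      (fun a b => b₂.κ * a₁ * ν * Real.exp (ρ₁ * r) * Real.exp (-(ρ₁ * g.dist a b))) := by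
  refine (hasMaj_comp h₁ h₂ fun a b => mul_nonneg ha₁ (Real.exp_nonneg _)).mono fun a b => ?_
  have hterm : ∀ y : g.Site, a₁ * Real.exp (-(ρ₁ * g.dist a y)) * (b₂.κ * K₂ y b) ≤
      a₁ * (Real.exp (ρ₁ * r) * Real.exp (-(ρ₁ * g.dist a b))) * (b₂.κ * K₂ y b) := by
    intro y
    by_cases hz : K₂ y b = 0
    · simp [hz]
    · exact mul_le_mul_of_nonneg_right
        (mul_le_mul_of_nonneg_left (exp_shift_right htri hρ₁ (hloc y b hz)) ha₁)
        (mul_nonneg b₂.κ_nonneg (hK₂ y b))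
  calc ∑ y : g.Site, a₁ * Real.exp (-(ρ₁ * g.dist a y)) * (b₂.κ * K₂ y b)
      ≤ ∑ y : g.Site, a₁ * (Real.exp (ρ₁ * r) * Real.exp (-(ρ₁ * g.dist a b))) * (b₂.κ * K₂ y b) :=
        Finset.sum_le_sum fun y _ => hterm y
    _ = a₁ * (Real.exp (ρ₁ * r) * Real.exp (-(ρ₁ * g.dist a b))) * b₂.κ * ∑ y : g.Site, K₂ y b := by
        rw [Finset.mul_sum]
        exact Finset.sum_congr rfl fun y _ => by ring
    _ ≤ a₁ * (Real.exp (ρ₁ * r) * Real.exp (-(ρ₁ * g.dist a b))) * b₂.κ * ν :=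
        mul_le_mul_of_nonneg_left (hcol b)
          (mul_nonneg (mul_nonneg ha₁ (mul_nonneg (Real.exp_nonneg _) (Real.exp_nonneg _))) b₂.κ_nonneg)
    _ = _ := by ring

/-- **A LOCAL operator on the LEFT of a decaying one, rate preserved.**  If T₂ : F₁ → F₂ has majorant
a₂·e^{−ρ₂d(y″,y′)} (a₂, ρ₂ ≥ 0) and T₁ : F₂ → F₃ has a majorant K₁ ≥ 0 which is local of range r with ROW sums
Σ_{y″} K₁(y, y″) ≤ ν, then T₁T₂ has majorant κ₂·a₂·ν·e^{ρ₂r}·e^{−ρ₂d(y,y′)}.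
[cite: Balaban1984PropagatorsII, (2.52)–(2.55) pp.232–233] -/
theorem hasMaj_comp_localLeft {b₁ : BlockNorm g F₁} {b₂ : BlockNorm g F₂} {b₃ : BlockNorm g F₃}
    {T₁ : F₂ →ₗ[ℝ] F₃} {T₂ : F₁ →ₗ[ℝ] F₂} {K₁ : g.Site → g.Site → ℝ} {a₂ ρ₂ r ν : ℝ}
    (htri : Triangle254 g) (ha₂ : 0 ≤ a₂) (hρ₂ : 0 ≤ ρ₂)
    (hK₁ : ∀ a b, 0 ≤ K₁ a b) (hloc : ∀ a b, K₁ a b ≠ 0 → g.dist a b ≤ r) (hrow : ∀ a, ∑ b : g.Site, K₁ a b ≤ ν)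
    (h₁ : HasMaj b₂ b₃ T₁ K₁)
    (h₂ : HasMaj b₁ b₂ T₂ (fun a b => a₂ * Real.exp (-(ρ₂ * g.dist a b)))) :
    HasMaj b₁ b₃ (T₁ ∘ₗ T₂)
      (fun a b => b₂.κ * a₂ * ν * Real.exp (ρ₂ * r) * Real.exp (-(ρ₂ * g.dist a b))) := by
  refine (hasMaj_comp h₁ h₂ hK₁).mono fun a b => ?_
  have hterm : ∀ y : g.Site, K₁ a y * (b₂.κ * (a₂ * Real.exp (-(ρ₂ * g.dist y b)))) ≤
      K₁ a y * (b₂.κ * (a₂ * (Real.exp (ρ₂ * r) * Real.exp (-(ρ₂ * g.dist a b))))) := by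
    intro y
    by_cases hz : K₁ a y = 0
    · simp [hz]
    · exact mul_le_mul_of_nonneg_left
        (mul_le_mul_of_nonneg_left
          (mul_le_mul_of_nonneg_left (exp_shift_left htri hρ₂ (hloc a y hz)) ha₂) b₂.κ_nonneg)
        (hK₁ a y)
  calc ∑ y : g.Site, K₁ a y * (b₂.κ * (a₂ * Real.exp (-(ρ₂ * g.dist y b))))
      ≤ ∑ y : g.Site, K₁ a y * (b₂.κ * (a₂ * (Real.exp (ρ₂ * r) * Real.exp (-(ρ₂ * g.dist a b))))) :=
        Finset.sum_le_sum fun y _ => hterm y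
    _ = (∑ y : g.Site, K₁ a y) * (b₂.κ * (a₂ * (Real.exp (ρ₂ * r) * Real.exp (-(ρ₂ * g.dist a b))))) := by
        rw [Finset.sum_mul]
    _ ≤ ν * (b₂.κ * (a₂ * (Real.exp (ρ₂ * r) * Real.exp (-(ρ₂ * g.dist a b))))) :=
        mul_le_mul_of_nonneg_right (hrow a)
          (mul_nonneg b₂.κ_nonneg (mul_nonneg ha₂ (mul_nonneg (Real.exp_nonneg _) (Real.exp_nonneg _))))
    _ = _ := by ring

/-! ## (2)–(4) Stability of (190) under a local change of the datum -/

section Ineq190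

variable {FA FB FB' : Type} [AddCommGroup FA] [Module ℝ FA] [AddCommGroup FB] [Module ℝ FB]
  [AddCommGroup FB'] [Module ℝ FB']

/-- **(190) composed with a local right factor.**  If δ𝓗 satisfies (190) from the B-size `bB` into the local size
`bout` (constant C ≥ 0, rate ⅛δ₀, δ₀ ≥ 0) and Φ′ : B′ ↦ B has a local majorant of range r with column sums ≤ ν, then
δ𝓗 ∘ Φ′ satisfies (190) from the B′-size with constant κ_B·C·ν·e^{⅛δ₀r} and the SAME rate ⅛δ₀.
[cite: Balaban1985Variational, (190) p.308 + Prop. 9 p.309; Balaban1984PropagatorsII, (2.54) p.233] -/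
theorem ineq190_comp_local {bB' : BlockNorm g FB'} {bB : BlockNorm g FB} {bout : BlockNorm g FA}
    {dH : FB →ₗ[ℝ] FA} {Φ : FB' →ₗ[ℝ] FB} {K : g.Site → g.Site → ℝ} {C δ₀ r ν : ℝ}
    (htri : Triangle254 g) (hC : 0 ≤ C) (hδ₀ : 0 ≤ δ₀)
    (hK : ∀ a b, 0 ≤ K a b) (hloc : ∀ a b, K a b ≠ 0 → g.dist a b ≤ r) (hcol : ∀ b, ∑ a : g.Site, K a b ≤ ν)
    (h190 : Ineq190 bB bout dH C δ₀) (hΦ : HasMaj bB' bB Φ K) :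
    Ineq190 bB' bout (dH ∘ₗ Φ) (bB.κ * C * ν * Real.exp (δ₀ / 8 * r)) δ₀ := by
  unfold Ineq190 at h190 ⊢
  exact hasMaj_comp_localRight htri hC (div_nonneg hδ₀ (by norm_num)) hK hloc hcol h190 hΦ

/-- **(190) is stable under the reparametrisation B = Φ(B′), DΦ = I + N with N local** (the chain rule of cell GAPS
G-B11-G5: δ𝓗/δB′ = (δ𝓗/δB)∘DΦ).  If δ𝓗 satisfies (190) with constant C and N has a local majorant of range r with
column sums ≤ ν, then δ𝓗 ∘ (I + N) satisfies (190) with constant C·(1 + κ_B ν e^{⅛δ₀r}) and the SAME rate ⅛δ₀.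
[cite: Balaban1985Variational, (190) p.308 + Prop. 9 p.309 + (20) p.281 + (154)–(156) p.302] -/
theorem ineq190_reparam {bB : BlockNorm g FB} {bout : BlockNorm g FA}
    {dH : FB →ₗ[ℝ] FA} {N : FB →ₗ[ℝ] FB} {K : g.Site → g.Site → ℝ} {C δ₀ r ν : ℝ}
    (htri : Triangle254 g) (hC : 0 ≤ C) (hδ₀ : 0 ≤ δ₀)
    (hK : ∀ a b, 0 ≤ K a b) (hloc : ∀ a b, K a b ≠ 0 → g.dist a b ≤ r) (hcol : ∀ b, ∑ a : g.Site, K a b ≤ ν)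
    (h190 : Ineq190 bB bout dH C δ₀) (hN : HasMaj bB bB N K) :
    Ineq190 bB bout (dH ∘ₗ (LinearMap.id + N)) (C * (1 + bB.κ * ν * Real.exp (δ₀ / 8 * r))) δ₀ := by
  have h₁ := ineq190_comp_local htri hC hδ₀ hK hloc hcol h190 hN
  unfold Ineq190 at h190 h₁ ⊢
  refine ((h190.add h₁).congr fun μ => ?_).mono fun a b => le_of_eq ?_
  · simp only [LinearMap.add_apply, LinearMap.comp_apply, LinearMap.id_apply, map_add]
  · ring

/-- The case r = 1 of `ineq190_reparam` — the range of the interface correction of (154)/(1.31) [6] (*"x₁ ∈ B(x)"*):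
constant C·(1 + κ_B ν e^{⅛δ₀}), rate ⅛δ₀. [cite: Balaban1985Variational, (154) p.302 + (190) p.308] -/
theorem ineq190_reparam_one {bB : BlockNorm g FB} {bout : BlockNorm g FA}
    {dH : FB →ₗ[ℝ] FA} {N : FB →ₗ[ℝ] FB} {K : g.Site → g.Site → ℝ} {C δ₀ ν : ℝ}
    (htri : Triangle254 g) (hC : 0 ≤ C) (hδ₀ : 0 ≤ δ₀)
    (hK : ∀ a b, 0 ≤ K a b) (hloc : ∀ a b, K a b ≠ 0 → g.dist a b ≤ 1) (hcol : ∀ b, ∑ a : g.Site, K a b ≤ ν)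
    (h190 : Ineq190 bB bout dH C δ₀) (hN : HasMaj bB bB N K) :
    Ineq190 bB bout (dH ∘ₗ (LinearMap.id + N)) (C * (1 + bB.κ * ν * Real.exp (δ₀ / 8))) δ₀ := by
  simpa using ineq190_reparam htri hC hδ₀ hK hloc hcol h190 hN

/-- Entry-wise family form (one (190) per local size `bout i`, as the consumers `B12Ineq45` / `B12Decay510FromB11`
take it): every entry is reparametrised with the same constant. [cite: Balaban1985Variational, (190) p.308] -/
theorem ineq190_reparam_entries {ι : Type} {bB : BlockNorm g FB} {bout : ι → BlockNorm g FA}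
    {dH : FB →ₗ[ℝ] FA} {N : FB →ₗ[ℝ] FB} {K : g.Site → g.Site → ℝ} {C δ₀ r ν : ℝ}
    (htri : Triangle254 g) (hC : 0 ≤ C) (hδ₀ : 0 ≤ δ₀)
    (hK : ∀ a b, 0 ≤ K a b) (hloc : ∀ a b, K a b ≠ 0 → g.dist a b ≤ r) (hcol : ∀ b, ∑ a : g.Site, K a b ≤ ν)
    (h190 : ∀ i, Ineq190 bB (bout i) dH C δ₀) (hN : HasMaj bB bB N K) (i : ι) :
    Ineq190 bB (bout i) (dH ∘ₗ (LinearMap.id + N)) (C * (1 + bB.κ * ν * Real.exp (δ₀ / 8 * r))) δ₀ :=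
  ineq190_reparam htri hC hδ₀ hK hloc hcol (h190 i) hN

/-- The constant of `ineq190_reparam` is ≥ C (the reparametrised bound is never better than the original) and is
nonnegative. [folklore] -/
theorem le_reparam_const {C κ ν δ₀ r : ℝ} (hC : 0 ≤ C) (hκ : 0 ≤ κ) (hν : 0 ≤ ν) :
    C ≤ C * (1 + κ * ν * Real.exp (δ₀ / 8 * r)) := by
  have : 0 ≤ κ * ν * Real.exp (δ₀ / 8 * r) := mul_nonneg (mul_nonneg hκ hν) (Real.exp_nonneg _)
  nlinarith

/-- **(190) followed by a local LEFT factor** (a local linear operation E on the output, read as an operator from the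
local size `bout` to a local size `bout′` with a local majorant of range r and row sums ≤ ν): E ∘ δ𝓗 satisfies (190)
into `bout′` with constant κ_out·C·ν·e^{⅛δ₀r}, rate ⅛δ₀. [cite: Balaban1985Variational, (190) p.308] -/
theorem ineq190_postcomp_local {FA' : Type} [AddCommGroup FA'] [Module ℝ FA']
    {bB : BlockNorm g FB} {bout : BlockNorm g FA} {bout' : BlockNorm g FA'}
    {dH : FB →ₗ[ℝ] FA} {E : FA →ₗ[ℝ] FA'} {K : g.Site → g.Site → ℝ} {C δ₀ r ν : ℝ}
    (htri : Triangle254 g) (hC : 0 ≤ C) (hδ₀ : 0 ≤ δ₀)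
    (hK : ∀ a b, 0 ≤ K a b) (hloc : ∀ a b, K a b ≠ 0 → g.dist a b ≤ r) (hrow : ∀ a, ∑ b : g.Site, K a b ≤ ν)
    (h190 : Ineq190 bB bout dH C δ₀) (hE : HasMaj bout bout' E K) :
    Ineq190 bB bout' (E ∘ₗ dH) (bout.κ * C * ν * Real.exp (δ₀ / 8 * r)) δ₀ := by
  unfold Ineq190 at h190 ⊢
  exact hasMaj_comp_localLeft htri hC (div_nonneg hδ₀ (by norm_num)) hK hloc hrow hE h190

end Ineq190

end Literature.MathematicalPhysics.QuantumFieldTheory.Balaban1983to89.B11Reparam190
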